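import Summits.HodgeConjecture.CorCM.SimpleCMProductsDimLeThreeBlocks
import Summits.HodgeConjecture.CorCM.MultiFieldWeilSeparatedThreefoldFactorsWitnessed
import Literature.FieldTheory.Galois.NormalClosureDegree
import HarnessLib

/-!
# MULTI-FIELD WEIL ENGINE — THE 𝔖₃ LEMMA: sextic CM fields SHARING an imaginary quadratic field and having ONE Galois closure in `ℂ` are ISOMORPHIC

Cell `pub-hodgecm2` (COR-CM), seat b30 gen 37 (2026-08-25); count-neutral own lane MULTI-FIELD WEIL ENGINE (stem `MultiFieldWeil*`).  Theorems only; no definition, no named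
fact, no `sorry`.  `HC_CM` is NOT touched.  PURPOSE: the family ∕ variety theorems `CorCM/MultiFieldWeilThreePerField{Families,Factors}.lean` ask, for two sextic slots SHARING
an imaginary quadratic field, that their Galois closures in `ℂ` DIFFER — «in truth non-isomorphic fields; asked in the closure form because two k-group members with one closure
cannot be separated by the tree's Galois theory».  This file supplies that Galois theory, so that the hypothesis becomes «NON-ISOMORPHIC fields» (files
`CorCM/MultiFieldWeilClassesPerField{Families,Factors}.lean`).

* `exists_conj_smul_eq_of_card_eq_pow_factorization` — GROUPS: subgroups `H₀, H₁ ≤ N ≤ G` of order `p^{v_p |N|}` are conjugate by an element of `N` (Sylow `p`-subgroups of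
  `N`; Mathlib's `Sylow.isPretransitive_of_finite`); `exists_map_eq_of_card_fixingSubgroup` ∕ `nonempty_algEquiv_of_card_fixingSubgroup` — the Galois-correspondence
  reading: intermediate fields `M₀, M₁ ⊇ k` of a finite Galois `E/F` whose fixing groups are Sylow in `Gal(E/k)` are Galois translates, hence `F`-isomorphic.
* **`nonempty_ringEquiv_of_quadratic_of_normalClosure_eq`** — `K₀` a SEXTIC CM field with a totally complex quadratic subfield `F`, `K₁` a sextic number field receiving `F`,
  `normalClosure ℚ K₀ ℂ = normalClosure ℚ K₁ ℂ =: L` ⟹ `K₀ ≃ K₁`.  PROOF.  The images `M₀ ⊇ k̃ ⊆ M₁` of `K₀ ⊇ F ↪ K₁` in `L` (ONE image `k̃` of the normal extension `F/ℚ`);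
  `[L:ℚ] ∈ {6, 12}` (seat b16's `finrank_normalClosure_of_quadratic`, Dodson), so `N = Gal(L/k̃)` has order `3` or `6` and `H_i = Gal(L/M_i) ≤ N` has order `[L:ℚ]/6 = 1` or
  `2 = 2^{v₂|N|}`: the `H_i` are Sylow `2`-subgroups of `N`, conjugate by some `n ∈ N`, whence `M₁ = L^{H₁} = L^{nH₀n⁻¹} = n(M₀)` and `K₁ ≃ M₁ ≃ M₀ ≃ K₀`.  (Without the
  shared `k̃` this is false: the sisters `k·F⁺`, `k′·F⁺` inside `k·k′·L(F⁺)` — seat b16's census, `CorCM/MultiFieldWeilPairAdditiveBlocks`.)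
* COROLLARIES (the forms consumed downstream): for sextic CM fields sharing an imaginary quadratic field, ONE closure ⟺ `Hom(K₀, K₁) ≠ ∅` ⟺ `K₀ ≃ K₁`
  (`normalClosure_eq_iff_nonempty_ringHom_of_sharedQuadratic`, `normalClosure_eq_iff_nonempty_ringEquiv_of_sharedQuadratic`), and
  `normalClosure_ne_of_sharedQuadratic_of_isEmpty_ringHom` ∕ `…_of_isEmpty_ringEquiv`.

[cite: Lang2002, I §6 Thm. 6.4 (ii); VI §1 Thm. 1.1 and Cor. 1.6] [cite: Dodson1984, §5.1.2 Theorem] [cite: Shimura1998, §8.4]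

## References
* [Lang2002] S. Lang, *Algebra*, GTM 211 (2002), I §6 (Sylow subgroups: all `p`-Sylow subgroups are conjugate), VI §1 (Galois correspondence).
* [Dodson1984] B. Dodson, *The structure of Galois groups of CM-fields*, Trans. AMS 283 (1984), §5.1.2.
* [Shimura1998] G. Shimura, *Abelian Varieties with Complex Multiplication and Modular Functions*, §8.4.
-/

noncomputable section

open NumberField Module IntermediateField

namespace Summit.HodgeConjecture.CorCM.MultiFieldWeil

open scoped Pointwise

/-! ## §0 Groups and the Galois correspondence: subgroups of order `p^{v_p|N|}` inside `N` are conjugate in `N` -/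

section Groups

/-- **Two subgroups `H₀, H₁ ≤ N` of a finite group `G`, both of order `p^{v_p |N|}`, are conjugate by an element of `N`**: read inside `N` they are Sylow
`p`-subgroups, and all Sylow `p`-subgroups of a finite group are conjugate. [cite: Lang2002, I §6 Thm. 6.4 (ii)] -/
theorem exists_conj_smul_eq_of_card_eq_pow_factorization {G : Type*} [Group G] [Finite G] {p : ℕ} [Fact p.Prime] {N H₀ H₁ : Subgroup G}
    (h₀ : H₀ ≤ N) (h₁ : H₁ ≤ N) (hc₀ : Nat.card H₀ = p ^ (Nat.card N).factorization p) (hc₁ : Nat.card H₁ = p ^ (Nat.card N).factorization p) :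
    ∃ n ∈ N, H₁ = MulAut.conj n • H₀ := by
  have hc₀' : Nat.card (H₀.subgroupOf N) = p ^ (Nat.card N).factorization p := by
    rw [← hc₀]; exact Nat.card_congr (Subgroup.subgroupOfEquivOfLe h₀).toEquiv
  have hc₁' : Nat.card (H₁.subgroupOf N) = p ^ (Nat.card N).factorization p := by
    rw [← hc₁]; exact Nat.card_congr (Subgroup.subgroupOfEquivOfLe h₁).toEquiv
  obtain ⟨n, hn⟩ := MulAction.exists_smul_eq (↥N) (Sylow.ofCard _ hc₀') (Sylow.ofCard _ hc₁')
  have hn' : MulAut.conj n • H₀.subgroupOf N = H₁.subgroupOf N := by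
    simpa [Sylow.coe_subgroup_smul] using congrArg Sylow.toSubgroup hn
  refine ⟨n, n.2, ?_⟩
  ext x
  constructor
  · intro hx
    have hxN : x ∈ N := h₁ hx
    have h2 : (⟨x, hxN⟩ : ↥N) ∈ H₁.subgroupOf N := by simpa [Subgroup.mem_subgroupOf] using hx
    rw [← hn', Subgroup.mem_pointwise_smul_iff_inv_smul_mem] at h2
    rw [Subgroup.mem_pointwise_smul_iff_inv_smul_mem]
    simpa [Subgroup.mem_subgroupOf] using h2
  · intro hx
    rw [Subgroup.mem_pointwise_smul_iff_inv_smul_mem] at hx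
    have hx' : (n : G)⁻¹ * x * n ∈ H₀ := by simpa using hx
    have hxN : x ∈ N := by
      have h3 : (n : G) * ((n : G)⁻¹ * x * n) * (n : G)⁻¹ ∈ N := N.mul_mem (N.mul_mem n.2 (h₀ hx')) (N.inv_mem n.2)
      simpa [mul_assoc] using h3
    have h2 : (⟨x, hxN⟩ : ↥N) ∈ MulAut.conj n • H₀.subgroupOf N := by
      rw [Subgroup.mem_pointwise_smul_iff_inv_smul_mem]
      simpa [Subgroup.mem_subgroupOf] using hx'
    rw [hn'] at h2
    simpa [Subgroup.mem_subgroupOf] using h2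

/-- **Galois correspondence form.**  `E/F` finite Galois, `k ≤ M₀`, `k ≤ M₁` intermediate fields whose fixing groups `Gal(E/M_i)` have order `p^{v_p [E:k]}` (Sylow
`p`-subgroups of `Gal(E/k)`): some `σ ∈ Gal(E/F)` maps `M₀` onto `M₁` (`Gal(E/M₁) = σ Gal(E/M₀) σ⁻¹ = Gal(E/σM₀)` and the correspondence is injective).
[cite: Lang2002, I §6 Thm. 6.4 (ii); VI §1 Thm. 1.1 and Cor. 1.6] -/
theorem exists_map_eq_of_card_fixingSubgroup {F E : Type*} [Field F] [Field E] [Algebra F E] [FiniteDimensional F E] [IsGalois F E]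
    {k M₀ M₁ : IntermediateField F E} (hk₀ : k ≤ M₀) (hk₁ : k ≤ M₁) {p : ℕ} [Fact p.Prime]
    (hc₀ : Nat.card M₀.fixingSubgroup = p ^ (Nat.card k.fixingSubgroup).factorization p)
    (hc₁ : Nat.card M₁.fixingSubgroup = p ^ (Nat.card k.fixingSubgroup).factorization p) :
    ∃ σ : E ≃ₐ[F] E, M₀.map (σ : E →ₐ[F] E) = M₁ := by
  obtain ⟨σ, -, hσ⟩ := exists_conj_smul_eq_of_card_eq_pow_factorization (fixingSubgroup_le hk₀) (fixingSubgroup_le hk₁) hc₀ hc₁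
  refine ⟨σ, ?_⟩
  have h := IsGalois.map_fixingSubgroup M₀ σ
  rw [← hσ] at h
  rw [← IsGalois.fixedField_fixingSubgroup (M₀.map (σ : E →ₐ[F] E)), h, IsGalois.fixedField_fixingSubgroup]

/-- **… hence `M₀ ≃ M₁` over `F`.** [cite: Lang2002, I §6 Thm. 6.4 (ii); VI §1 Thm. 1.1 and Cor. 1.6] -/
theorem nonempty_algEquiv_of_card_fixingSubgroup {F E : Type*} [Field F] [Field E] [Algebra F E] [FiniteDimensional F E] [IsGalois F E]
    {k M₀ M₁ : IntermediateField F E} (hk₀ : k ≤ M₀) (hk₁ : k ≤ M₁) {p : ℕ} [Fact p.Prime]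
    (hc₀ : Nat.card M₀.fixingSubgroup = p ^ (Nat.card k.fixingSubgroup).factorization p)
    (hc₁ : Nat.card M₁.fixingSubgroup = p ^ (Nat.card k.fixingSubgroup).factorization p) : Nonempty (M₀ ≃ₐ[F] M₁) := by
  obtain ⟨σ, hσ⟩ := exists_map_eq_of_card_fixingSubgroup hk₀ hk₁ hc₀ hc₁
  exact ⟨(M₀.equivMap (σ : E →ₐ[F] E)).trans (equivOfEq hσ)⟩


end Groups

/-! ## §1 The 𝔖₃ lemma -/

section Fields

variable {K₀ K₁ : Type} [Field K₀] [NumberField K₀] [IsCMField K₀] [Field K₁] [NumberField K₁]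

/-- **THE 𝔖₃ LEMMA.**  `K₀` a SEXTIC CM field with a totally complex quadratic subfield `F`, `K₁` a sextic number field receiving `F`, and
`normalClosure ℚ K₀ ℂ = normalClosure ℚ K₁ ℂ`.  Then `K₀ ≃ K₁`: inside the common closure `L` (of degree `6` or `12`, seat b16's `finrank_normalClosure_of_quadratic`) the fixing
groups of the images of `K₀`, `K₁` have order `[L:ℚ]/6 ∈ {1, 2}` inside `Gal(L/k̃)` of order `[L:ℚ]/2 ∈ {3, 6}`, `k̃` the ONE image of the normal extension `F/ℚ` — Sylow
`2`-subgroups, hence conjugate, so one image is a Galois translate of the other.  (False without the shared `k̃`: the sisters `k·F⁺`, `k′·F⁺` in `k·k′·L(F⁺)`.)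
[cite: Lang2002, I §6 Thm. 6.4 (ii); VI §1 Thm. 1.1 and Cor. 1.6] [cite: Dodson1984, §5.1.2 Theorem] -/
theorem nonempty_ringEquiv_of_quadratic_of_normalClosure_eq (h6₀ : finrank ℚ K₀ = 6) (h6₁ : finrank ℚ K₁ = 6) (F : IntermediateField ℚ K₀)
    (hF2 : finrank ℚ F = 2) (hFtc : IsTotallyComplex F) (e : F →+* K₁) (hL : normalClosure ℚ K₀ ℂ = normalClosure ℚ K₁ ℂ) : Nonempty (K₀ ≃+* K₁) := by
  classical
  haveI := hFtc
  haveI : Algebra.IsQuadraticExtension ℚ F := { finrank_eq_two' := hF2 }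
  -- the closure `L`, Galois over `ℚ`, of degree `6` or `12`
  let L : Type := ↥(normalClosure ℚ K₀ ℂ)
  haveI : IsNormalClosure ℚ K₀ L := Algebra.IsAlgebraic.isNormalClosure_normalClosure fun x => IsAlgClosed.splits _
  haveI : NumberField L := { to_charZero := inferInstance, to_finiteDimensional := inferInstance }
  haveI : IsGalois ℚ L := Literature.NumberTheory.NumberFields.isGalois_normalClosure_complex K₀
  have hdeg : finrank ℚ L = 6 ∨ finrank ℚ L = 12 :=
    finrank_normalClosure_of_quadratic (K := fun _ : Unit => K₀) (i := ()) h6₀ hF2 (algebraMap F K₀)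
  -- the images `M₀ ⊇ k̃ ⊆ M₁` of `K₀ ⊇ F ↪ K₁` in `L`
  obtain ⟨x₀⟩ : Nonempty (K₀ →+* ℂ) := inferInstance
  obtain ⟨x₁⟩ : Nonempty (K₁ →+* ℂ) := inferInstance
  let j₀ : K₀ →ₐ[ℚ] L := x₀.toRatAlgHom.codRestrict (normalClosure ℚ K₀ ℂ).toSubalgebra fun y => x₀.toRatAlgHom.fieldRange_le_normalClosure ⟨y, rfl⟩
  have hx₁ : ∀ y, x₁.toRatAlgHom y ∈ (normalClosure ℚ K₀ ℂ).toSubalgebra := fun y => by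
    rw [IntermediateField.mem_toSubalgebra, hL]; exact x₁.toRatAlgHom.fieldRange_le_normalClosure ⟨y, rfl⟩
  let j₁ : K₁ →ₐ[ℚ] L := x₁.toRatAlgHom.codRestrict (normalClosure ℚ K₀ ℂ).toSubalgebra hx₁
  let M₀ : IntermediateField ℚ L := j₀.fieldRange
  let M₁ : IntermediateField ℚ L := j₁.fieldRange
  let q₀ : ↥F →ₐ[ℚ] L := j₀.comp F.val
  let q₁ : ↥F →ₐ[ℚ] L := j₁.comp e.toRatAlgHom
  let kt : IntermediateField ℚ L := q₀.fieldRange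
  have hq : q₁.fieldRange = kt :=
    (Literature.FieldTheory.Galois.normalClosure_eq_fieldRange_of_normal q₁).symm.trans
      (Literature.FieldTheory.Galois.normalClosure_eq_fieldRange_of_normal q₀)
  have hk₀ : kt ≤ M₀ := by
    rintro _ ⟨z, rfl⟩
    exact ⟨(z : K₀), rfl⟩
  have hk₁ : kt ≤ M₁ := by
    rw [← hq]
    rintro _ ⟨z, rfl⟩
    exact ⟨e z, rfl⟩
  -- degrees: `[k̃:ℚ] = 2`, `[M_i:ℚ] = 6`
  have hkt2 : finrank ℚ kt = 2 := ((AlgEquiv.ofInjectiveField q₀).toLinearEquiv.finrank_eq).symm.trans hF2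
  have hM₀6 : finrank ℚ M₀ = 6 := ((AlgEquiv.ofInjectiveField j₀).toLinearEquiv.finrank_eq).symm.trans h6₀
  have hM₁6 : finrank ℚ M₁ = 6 := ((AlgEquiv.ofInjectiveField j₁).toLinearEquiv.finrank_eq).symm.trans h6₁
  -- the groups `N = Gal(L/k̃) ⊇ H_i = Gal(L/M_i)` and their orders
  have hN : Nat.card kt.fixingSubgroup * 2 = finrank ℚ L := by
    rw [IsGalois.card_fixingSubgroup_eq_finrank, mul_comm, ← hkt2, Module.finrank_mul_finrank]
  have hH₀ : Nat.card M₀.fixingSubgroup * 6 = finrank ℚ L := by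
    rw [IsGalois.card_fixingSubgroup_eq_finrank, mul_comm, ← hM₀6, Module.finrank_mul_finrank]
  have hH₁ : Nat.card M₁.fixingSubgroup * 6 = finrank ℚ L := by
    rw [IsGalois.card_fixingSubgroup_eq_finrank, mul_comm, ← hM₁6, Module.finrank_mul_finrank]
  haveI : Fact (Nat.Prime 2) := ⟨Nat.prime_two⟩
  have hpow : ∀ {H : Subgroup (L ≃ₐ[ℚ] L)}, Nat.card H * 6 = finrank ℚ L → Nat.card H = 2 ^ (Nat.card kt.fixingSubgroup).factorization 2 := by
    intro H hH
    rcases hdeg with h | h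
    · have hNc : Nat.card kt.fixingSubgroup = 3 := by omega
      have hHc : Nat.card H = 1 := by omega
      rw [hNc, hHc, Nat.factorization_eq_zero_of_not_dvd (by norm_num), pow_zero]
    · have hNc : Nat.card kt.fixingSubgroup = 6 := by omega
      have hHc : Nat.card H = 2 := by omega
      have h6 : (6 : ℕ) = 2 ^ 1 * 3 := by norm_num
      rw [hNc, hHc, h6, Nat.factorization_mul_apply_of_coprime (by norm_num), Nat.Prime.factorization_pow Nat.prime_two, Finsupp.single_eq_same,
        Nat.factorization_eq_zero_of_not_dvd (show ¬ 2 ∣ 3 by norm_num), add_zero, pow_one]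
  -- Sylow: the two fixing groups are conjugate in `Gal(L/k̃)`, so `M₀ ≃ M₁`
  obtain ⟨ε⟩ := nonempty_algEquiv_of_card_fixingSubgroup hk₀ hk₁ (hpow hH₀) (hpow hH₁)
  exact ⟨(((AlgEquiv.ofInjectiveField j₀).trans ε).trans (AlgEquiv.ofInjectiveField j₁).symm).toRingEquiv⟩


end Fields

/-! ## §2 The forms consumed downstream: sharing an imaginary quadratic field — «one closure ⟺ `Hom ≠ ∅` ⟺ isomorphic» -/

section Consumers

variable {K₀ K₁ : Type} [Field K₀] [NumberField K₀] [IsCMField K₀] [Field K₁] [NumberField K₁]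

omit [IsCMField K₀] in
/-- **A homomorphism between number fields of one degree is an isomorphism.** [cite: Lang2002, V §1 Prop. 1.2] -/
theorem nonempty_ringEquiv_of_ringHom_of_finrank_eq (g : K₀ →+* K₁) (h : finrank ℚ K₀ = finrank ℚ K₁) : Nonempty (K₀ ≃+* K₁) := by
  have hinj : Function.Injective g.toRatAlgHom.toLinearMap := g.injective
  have hsurj : Function.Surjective g.toRatAlgHom.toLinearMap := (LinearMap.injective_iff_surjective_of_finrank_eq_finrank h).1 hinj
  exact ⟨(AlgEquiv.ofBijective g.toRatAlgHom ⟨hinj, hsurj⟩).toRingEquiv⟩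

/-- **For sextic CM fields SHARING an imaginary quadratic field: one Galois closure in `ℂ` ⟺ `Hom(K₀, K₁) ≠ ∅`** (⟸: a homomorphism between number fields of one degree is an
isomorphism, and isomorphic fields have one closure). [cite: Lang2002, I §6 Thm. 6.4 (ii); VI §1 Thm. 1.1 and Cor. 1.6] [cite: Dodson1984, §5.1.2 Theorem] -/
theorem normalClosure_eq_iff_nonempty_ringHom_of_sharedQuadratic (h6₀ : finrank ℚ K₀ = 6) (h6₁ : finrank ℚ K₁ = 6)
    (hsh : ∃ F : IntermediateField ℚ K₀, finrank ℚ F = 2 ∧ IsTotallyComplex F ∧ Nonempty (F →+* K₁)) :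
    normalClosure ℚ K₀ ℂ = normalClosure ℚ K₁ ℂ ↔ Nonempty (K₀ →+* K₁) := by
  refine ⟨fun hL => ?_, fun ⟨g⟩ => ?_⟩
  · obtain ⟨F, hF2, hFtc, ⟨e⟩⟩ := hsh
    obtain ⟨ε⟩ := nonempty_ringEquiv_of_quadratic_of_normalClosure_eq h6₀ h6₁ F hF2 hFtc e hL
    exact ⟨ε.toRingHom⟩
  · obtain ⟨ε⟩ := nonempty_ringEquiv_of_ringHom_of_finrank_eq g (h6₀.trans h6₁.symm)
    exact normalClosure_eq_of_ringEquiv ε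

/-- **… ⟺ the fields are isomorphic.** [cite: Lang2002, I §6 Thm. 6.4 (ii); VI §1 Thm. 1.1 and Cor. 1.6] [cite: Dodson1984, §5.1.2 Theorem] -/
theorem normalClosure_eq_iff_nonempty_ringEquiv_of_sharedQuadratic (h6₀ : finrank ℚ K₀ = 6) (h6₁ : finrank ℚ K₁ = 6)
    (hsh : ∃ F : IntermediateField ℚ K₀, finrank ℚ F = 2 ∧ IsTotallyComplex F ∧ Nonempty (F →+* K₁)) :
    normalClosure ℚ K₀ ℂ = normalClosure ℚ K₁ ℂ ↔ Nonempty (K₁ ≃+* K₀) := by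
  refine ⟨fun hL => ?_, fun ⟨ε⟩ => normalClosure_eq_of_ringEquiv ε.symm⟩
  obtain ⟨F, hF2, hFtc, ⟨e⟩⟩ := hsh
  obtain ⟨ε⟩ := nonempty_ringEquiv_of_quadratic_of_normalClosure_eq h6₀ h6₁ F hF2 hFtc e hL
  exact ⟨ε.symm⟩

/-- **The form consumed by the family ∕ variety theorems, «`Hom = ∅`» version**: two sextic CM fields sharing an imaginary quadratic field with `Hom(K₀, K₁) = ∅` have
DIFFERENT Galois closures in `ℂ`. [cite: Lang2002, I §6 Thm. 6.4 (ii); VI §1 Thm. 1.1 and Cor. 1.6] [cite: Dodson1984, §5.1.2 Theorem] -/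
theorem normalClosure_ne_of_sharedQuadratic_of_isEmpty_ringHom (h6₀ : finrank ℚ K₀ = 6) (h6₁ : finrank ℚ K₁ = 6)
    (hsh : ∃ F : IntermediateField ℚ K₀, finrank ℚ F = 2 ∧ IsTotallyComplex F ∧ Nonempty (F →+* K₁)) (hne : IsEmpty (K₀ →+* K₁)) :
    normalClosure ℚ K₀ ℂ ≠ normalClosure ℚ K₁ ℂ := fun hL =>
  hne.false (Classical.choice ((normalClosure_eq_iff_nonempty_ringHom_of_sharedQuadratic h6₀ h6₁ hsh).1 hL))

/-- **… «non-isomorphic» version.** [cite: Lang2002, I §6 Thm. 6.4 (ii); VI §1 Thm. 1.1 and Cor. 1.6] [cite: Dodson1984, §5.1.2 Theorem] -/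
theorem normalClosure_ne_of_sharedQuadratic_of_isEmpty_ringEquiv (h6₀ : finrank ℚ K₀ = 6) (h6₁ : finrank ℚ K₁ = 6)
    (hsh : ∃ F : IntermediateField ℚ K₀, finrank ℚ F = 2 ∧ IsTotallyComplex F ∧ Nonempty (F →+* K₁)) (hne : IsEmpty (K₁ ≃+* K₀)) :
    normalClosure ℚ K₀ ℂ ≠ normalClosure ℚ K₁ ℂ := fun hL =>
  hne.false (Classical.choice ((normalClosure_eq_iff_nonempty_ringEquiv_of_sharedQuadratic h6₀ h6₁ hsh).1 hL))

/-- **Read on two fields with one closure**: sextic CM fields sharing an imaginary quadratic field with ONE Galois closure admit homomorphisms in both directions.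
[cite: Lang2002, VI §1 Thm. 1.1 and Cor. 1.6] -/
theorem nonempty_ringHom_of_sharedQuadratic_of_normalClosure_eq (h6₀ : finrank ℚ K₀ = 6) (h6₁ : finrank ℚ K₁ = 6)
    (hsh : ∃ F : IntermediateField ℚ K₀, finrank ℚ F = 2 ∧ IsTotallyComplex F ∧ Nonempty (F →+* K₁)) (hL : normalClosure ℚ K₀ ℂ = normalClosure ℚ K₁ ℂ) :
    Nonempty (K₀ →+* K₁) ∧ Nonempty (K₁ →+* K₀) := by
  obtain ⟨ε⟩ := (normalClosure_eq_iff_nonempty_ringEquiv_of_sharedQuadratic h6₀ h6₁ hsh).1 hL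
  exact ⟨⟨ε.symm.toRingHom⟩, ⟨ε.toRingHom⟩⟩

end Consumers

/-! ## §3 At most two isomorphism classes of has-k sextic CM fields in one Galois closure -/

section Classes

variable {I : Type} {K : I → Type} [∀ i, Field (K i)] [∀ i, NumberField (K i)] [∀ i, IsCMField (K i)]

/-- **AT MOST TWO ISOMORPHISM CLASSES OF SEXTIC CM FIELDS WITH AN IMAGINARY QUADRATIC SUBFIELD IN ONE GALOIS CLOSURE.**  Three sextic CM fields `K_a, K_b, K_c`, each with a
totally complex quadratic subfield, with ONE Galois closure in `ℂ`: two of them are isomorphic.  (Seat b16's `false_of_three_quadratic_of_normalClosure_eq`: the three quadratic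
fields cannot pairwise fail to embed in the other fields; and an embedding `F_i ↪ K_j` makes `K_i ≃ K_j` by the 𝔖₃ lemma.  The two classes inside `k·k′·L(F⁺)`: `k·F⁺` and
`k′·F⁺`.) [cite: Dodson1984, §5.1.2 Theorem] [cite: Lang2002, I §6 Thm. 6.4 (ii); VI §1 Thm. 1.1 and Cor. 1.6] [cite: Shimura1998, §8.4] -/
theorem isomorphic_two_of_three_quadratic_of_normalClosure_eq {a b c : I} (hab : a ≠ b) (hac : a ≠ c) (hbc : b ≠ c)
    (h6 : ∀ i, finrank ℚ (K i) = 6) (F : ∀ i, IntermediateField ℚ (K i)) (hF2 : ∀ i, finrank ℚ (F i) = 2) (hFtc : ∀ i, IsTotallyComplex (F i))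
    (hL : ∀ i j, normalClosure ℚ (K i) ℂ = normalClosure ℚ (K j) ℂ) :
    Nonempty (K a ≃+* K b) ∨ Nonempty (K a ≃+* K c) ∨ Nonempty (K b ≃+* K c) := by
  classical
  by_contra hno
  simp only [not_or] at hno
  obtain ⟨hab', hac', hbc'⟩ := hno
  -- an embedding `F_i ↪ K_j` between two of the three fields makes them isomorphic (the 𝔖₃ lemma)
  have hiso : ∀ i j, Nonempty (F i →+* K j) → Nonempty (K i ≃+* K j) := fun i j ⟨e⟩ =>
    nonempty_ringEquiv_of_quadratic_of_normalClosure_eq (h6 i) (h6 j) (F i) (hF2 i) (hFtc i) e (hL i j)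
  -- restrict to the three-element sub-family and apply seat b16's pigeonhole
  let S : Type := {x : I // x = a ∨ x = b ∨ x = c}
  have hS : ∀ x y : S, x ≠ y → IsEmpty (F x.1 →+* K y.1) := by
    rintro ⟨x, hx⟩ ⟨y, hy⟩ hxy
    refine ⟨fun e => ?_⟩
    have hxy' : x ≠ y := fun h => hxy (Subtype.ext h)
    obtain ⟨ε⟩ := hiso x y ⟨e⟩
    rcases hx with rfl | rfl | rfl <;> rcases hy with rfl | rfl | rfl
    all_goals first | exact hxy' rfl | exact hab' ⟨ε⟩ | exact hab' ⟨ε.symm⟩ | exact hac' ⟨ε⟩ | exact hac' ⟨ε.symm⟩ | exact hbc' ⟨ε⟩ | exact hbc' ⟨ε.symm⟩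
  exact false_of_three_quadratic_of_normalClosure_eq (K := fun x : S => K x.1) (a := ⟨a, Or.inl rfl⟩) (b := ⟨b, Or.inr (Or.inl rfl)⟩) (c := ⟨c, Or.inr (Or.inr rfl)⟩)
    (fun h => hab (congrArg Subtype.val h)) (fun h => hac (congrArg Subtype.val h)) (fun h => hbc (congrArg Subtype.val h))
    (fun x => h6 x.1) (fun x => F x.1) (fun x => hF2 x.1) (fun x => hFtc x.1) (fun x y => hL x.1 y.1) hS

end Classes

end Summit.HodgeConjecture.CorCM.MultiFieldWeil

end
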